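import Summits.ValiantsHypothesis.ValiantsHypothesis.Theorems.KPlusLogSqLawTropicalBToeplitzFive

/-!
# Route `KPlusLogSqLaw`, crux `TropicalB` — Toeplitz sector: `Φ_Toep(5) ≤ 16` by a one-hub case split of the additive hypergraph

HONEST FRAMING.  Helper toward the registered stubs `stub_tropThin` / `stub_tropFat` of
`Cruxes/TropicalB/Lines/birth.lean` (crux `Summit.ValiantsHypothesis.ValiantsHypothesis.Theses.KPlusLogSqLaw.TropicalB`,
ledger item `stmt-ValiantsHypothesis-19771`, route `KPlusLogSqLaw`; cell `pub-symmetroid`, seat `val-sym-trop-p3`,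
2026-08-26).  Sharpens the `m = 5` row of the cell's Conjecture T table from `≤ 17` (`linearInstanceBound_five`, three disjoint
additive quadruples) to **`≤ 16`**: among the twenty unshared-profile permutations of `Fin 5` take the HUB `h = 43012` (it lies
in six additive relations).  If `h` is not a member of the chain, three pairwise disjoint quadruples avoiding `h` each lose a
member (`≤ 19 − 3`); if `h` is a member, its three LINK TRIPLES `{12340, 13042, 42310}`, `{21430, 23410, 41032}`,
`{34012, 43120, 34120}` (the other three permutations of a relation through `h`) and the quadruple
`{34201, 43210, 34210, 43201}` are pairwise disjoint and each loses a member (`≤ 20 − 4`).  Located, not formalised: the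
largest additive-free subset has `15` elements and the located value is `13` (`five_chain_13`), so `13 ≤ Φ_Toep(5) ≤ 16` is
the kernel row after this file.  Conjecture T is OPEN; nothing here bears on `TropicalB` for general designs, `KPlusLogSqLaw`,
`MatrixDescartes` or `VP ≠ VNP`.

References: folklore (independent sets of a hypergraph vs. disjoint edges / link of a vertex); `…ToeplitzAdditive`,
`…ToeplitzSmallSizes`, `…ToeplitzFive` (this seat).
-/

set_option linter.dupNamespace false
set_option autoImplicit false

namespace Summit.ValiantsHypothesis.ValiantsHypothesis.Theorems.KPlusLogSqLaw.Toeplitz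

open scoped BigOperators
open Finset

section FiveHub

variable {m N : ℕ}

/-- an additive quadruple loses a member: some element of `{s₁, s₂, s₃, s₄}` is not in the chain's image. [folklore] -/
theorem exists_not_mem_image_of_additive (ψ α : ℤ → ℤ) (P : ℤ → Prop) (θ' : Fin (N + 1) → ℤ)
    (τ : Fin (N + 1) → Equiv.Perm (Fin m)) (hθ : StrictMono θ') (hinj : Function.Injective τ)
    (hτP : ∀ k b, P ((τ k b : ℤ) - b))
    (huniq : ∀ k (σ : Equiv.Perm (Fin m)), σ ≠ τ k → (∀ b, P ((σ b : ℤ) - b)) →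
      ∑ b, (θ' k * ψ ((σ b : ℤ) - b) + α ((σ b : ℤ) - b)) <
        ∑ b, (θ' k * ψ ((τ k b : ℤ) - b) + α ((τ k b : ℤ) - b)))
    (s₁ s₂ s₃ s₄ : Equiv.Perm (Fin m)) (h13 : s₁ ≠ s₃) (h14 : s₁ ≠ s₄) (h23 : s₂ ≠ s₃) (h24 : s₂ ≠ s₄)
    (hrel : (univ.val.map fun i : Fin m => (s₁ i : ℤ) - i) + (univ.val.map fun i : Fin m => (s₂ i : ℤ) - i) =
      (univ.val.map fun i : Fin m => (s₃ i : ℤ) - i) + (univ.val.map fun i : Fin m => (s₄ i : ℤ) - i)) :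
    ∃ x ∈ ({s₁, s₂, s₃, s₄} : Finset (Equiv.Perm (Fin m))), x ∉ univ.image τ := by
  classical
  by_contra hh
  push Not at hh
  obtain ⟨a, -, ha⟩ := mem_image.mp (hh s₁ (by simp))
  obtain ⟨b, -, hb⟩ := mem_image.mp (hh s₂ (by simp))
  obtain ⟨c, -, hc⟩ := mem_image.mp (hh s₃ (by simp))
  obtain ⟨d, -, hd⟩ := mem_image.mp (hh s₄ (by simp))
  exact not_all_members_of_additive ψ α P θ' τ hθ hinj hτP huniq s₁ s₂ s₃ s₄ h13 h14 h23 h24 hrel ha hb hc hd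

/-- bookkeeping for the hub split (membership / disjointness of explicit permutation sets; `decide +kernel`). -/
theorem five_hub_factB1 :
    ∀ v ∈ ({(⟨![1, 2, 3, 4, 0], ![4, 0, 1, 2, 3], by decide, by decide⟩ : Equiv.Perm (Fin 5)),
        (⟨![4, 3, 0, 1, 2], ![2, 3, 4, 1, 0], by decide, by decide⟩ : Equiv.Perm (Fin 5)),
        (⟨![1, 3, 0, 4, 2], ![2, 0, 4, 1, 3], by decide, by decide⟩ : Equiv.Perm (Fin 5)),
        (⟨![4, 2, 3, 1, 0], ![4, 3, 1, 2, 0], by decide, by decide⟩ : Equiv.Perm (Fin 5))} : Finset (Equiv.Perm (Fin 5))),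
      v ≠ (⟨![4, 3, 0, 1, 2], ![2, 3, 4, 1, 0], by decide, by decide⟩ : Equiv.Perm (Fin 5)) → v ∈ (univ.filter fun σ : Equiv.Perm (Fin 5) => ∀ σ' : Equiv.Perm (Fin 5),
      (univ.val.map fun b : Fin 5 => (σ' b : ℤ) - b) = (univ.val.map fun b : Fin 5 => (σ b : ℤ) - b) → σ' = σ) ∧
      v ∉ ({(⟨![2, 1, 4, 3, 0], ![4, 1, 0, 3, 2], by decide, by decide⟩ : Equiv.Perm (Fin 5)),
        (⟨![4, 3, 0, 1, 2], ![2, 3, 4, 1, 0], by decide, by decide⟩ : Equiv.Perm (Fin 5)),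
        (⟨![2, 3, 4, 1, 0], ![4, 3, 0, 1, 2], by decide, by decide⟩ : Equiv.Perm (Fin 5)),
        (⟨![4, 1, 0, 3, 2], ![2, 1, 4, 3, 0], by decide, by decide⟩ : Equiv.Perm (Fin 5))} : Finset (Equiv.Perm (Fin 5))) ∧
      v ∉ ({(⟨![3, 4, 0, 1, 2], ![2, 3, 4, 0, 1], by decide, by decide⟩ : Equiv.Perm (Fin 5)),
        (⟨![4, 3, 1, 2, 0], ![4, 2, 3, 1, 0], by decide, by decide⟩ : Equiv.Perm (Fin 5)),
        (⟨![3, 4, 1, 2, 0], ![4, 2, 3, 0, 1], by decide, by decide⟩ : Equiv.Perm (Fin 5)),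
        (⟨![4, 3, 0, 1, 2], ![2, 3, 4, 1, 0], by decide, by decide⟩ : Equiv.Perm (Fin 5))} : Finset (Equiv.Perm (Fin 5))) ∧
      v ∉ ({(⟨![3, 4, 2, 0, 1], ![3, 4, 2, 0, 1], by decide, by decide⟩ : Equiv.Perm (Fin 5)),
        (⟨![4, 3, 2, 1, 0], ![4, 3, 2, 1, 0], by decide, by decide⟩ : Equiv.Perm (Fin 5)),
        (⟨![3, 4, 2, 1, 0], ![4, 3, 2, 0, 1], by decide, by decide⟩ : Equiv.Perm (Fin 5)),
        (⟨![4, 3, 2, 0, 1], ![3, 4, 2, 1, 0], by decide, by decide⟩ : Equiv.Perm (Fin 5))} : Finset (Equiv.Perm (Fin 5))) := by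
  decide +kernel

/-- bookkeeping for the hub split (membership / disjointness of explicit permutation sets; `decide +kernel`). -/
theorem five_hub_factB2 :
    ∀ v ∈ ({(⟨![2, 1, 4, 3, 0], ![4, 1, 0, 3, 2], by decide, by decide⟩ : Equiv.Perm (Fin 5)),
        (⟨![4, 3, 0, 1, 2], ![2, 3, 4, 1, 0], by decide, by decide⟩ : Equiv.Perm (Fin 5)),
        (⟨![2, 3, 4, 1, 0], ![4, 3, 0, 1, 2], by decide, by decide⟩ : Equiv.Perm (Fin 5)),
        (⟨![4, 1, 0, 3, 2], ![2, 1, 4, 3, 0], by decide, by decide⟩ : Equiv.Perm (Fin 5))} : Finset (Equiv.Perm (Fin 5))),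
      v ≠ (⟨![4, 3, 0, 1, 2], ![2, 3, 4, 1, 0], by decide, by decide⟩ : Equiv.Perm (Fin 5)) → v ∈ (univ.filter fun σ : Equiv.Perm (Fin 5) => ∀ σ' : Equiv.Perm (Fin 5),
      (univ.val.map fun b : Fin 5 => (σ' b : ℤ) - b) = (univ.val.map fun b : Fin 5 => (σ b : ℤ) - b) → σ' = σ) ∧
      v ∉ ({(⟨![3, 4, 0, 1, 2], ![2, 3, 4, 0, 1], by decide, by decide⟩ : Equiv.Perm (Fin 5)),
        (⟨![4, 3, 1, 2, 0], ![4, 2, 3, 1, 0], by decide, by decide⟩ : Equiv.Perm (Fin 5)),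
        (⟨![3, 4, 1, 2, 0], ![4, 2, 3, 0, 1], by decide, by decide⟩ : Equiv.Perm (Fin 5)),
        (⟨![4, 3, 0, 1, 2], ![2, 3, 4, 1, 0], by decide, by decide⟩ : Equiv.Perm (Fin 5))} : Finset (Equiv.Perm (Fin 5))) ∧
      v ∉ ({(⟨![3, 4, 2, 0, 1], ![3, 4, 2, 0, 1], by decide, by decide⟩ : Equiv.Perm (Fin 5)),
        (⟨![4, 3, 2, 1, 0], ![4, 3, 2, 1, 0], by decide, by decide⟩ : Equiv.Perm (Fin 5)),
        (⟨![3, 4, 2, 1, 0], ![4, 3, 2, 0, 1], by decide, by decide⟩ : Equiv.Perm (Fin 5)),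
        (⟨![4, 3, 2, 0, 1], ![3, 4, 2, 1, 0], by decide, by decide⟩ : Equiv.Perm (Fin 5))} : Finset (Equiv.Perm (Fin 5))) := by
  decide +kernel

/-- bookkeeping for the hub split (membership / disjointness of explicit permutation sets; `decide +kernel`). -/
theorem five_hub_factB3 :
    ∀ v ∈ ({(⟨![3, 4, 0, 1, 2], ![2, 3, 4, 0, 1], by decide, by decide⟩ : Equiv.Perm (Fin 5)),
        (⟨![4, 3, 1, 2, 0], ![4, 2, 3, 1, 0], by decide, by decide⟩ : Equiv.Perm (Fin 5)),
        (⟨![3, 4, 1, 2, 0], ![4, 2, 3, 0, 1], by decide, by decide⟩ : Equiv.Perm (Fin 5)),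
        (⟨![4, 3, 0, 1, 2], ![2, 3, 4, 1, 0], by decide, by decide⟩ : Equiv.Perm (Fin 5))} : Finset (Equiv.Perm (Fin 5))),
      v ≠ (⟨![4, 3, 0, 1, 2], ![2, 3, 4, 1, 0], by decide, by decide⟩ : Equiv.Perm (Fin 5)) → v ∈ (univ.filter fun σ : Equiv.Perm (Fin 5) => ∀ σ' : Equiv.Perm (Fin 5),
      (univ.val.map fun b : Fin 5 => (σ' b : ℤ) - b) = (univ.val.map fun b : Fin 5 => (σ b : ℤ) - b) → σ' = σ) ∧
      v ∉ ({(⟨![3, 4, 2, 0, 1], ![3, 4, 2, 0, 1], by decide, by decide⟩ : Equiv.Perm (Fin 5)),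
        (⟨![4, 3, 2, 1, 0], ![4, 3, 2, 1, 0], by decide, by decide⟩ : Equiv.Perm (Fin 5)),
        (⟨![3, 4, 2, 1, 0], ![4, 3, 2, 0, 1], by decide, by decide⟩ : Equiv.Perm (Fin 5)),
        (⟨![4, 3, 2, 0, 1], ![3, 4, 2, 1, 0], by decide, by decide⟩ : Equiv.Perm (Fin 5))} : Finset (Equiv.Perm (Fin 5))) := by
  decide +kernel

/-- bookkeeping for the hub split (membership / disjointness of explicit permutation sets; `decide +kernel`). -/
theorem five_hub_factB4 :
    ∀ v ∈ ({(⟨![3, 4, 2, 0, 1], ![3, 4, 2, 0, 1], by decide, by decide⟩ : Equiv.Perm (Fin 5)),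
        (⟨![4, 3, 2, 1, 0], ![4, 3, 2, 1, 0], by decide, by decide⟩ : Equiv.Perm (Fin 5)),
        (⟨![3, 4, 2, 1, 0], ![4, 3, 2, 0, 1], by decide, by decide⟩ : Equiv.Perm (Fin 5)),
        (⟨![4, 3, 2, 0, 1], ![3, 4, 2, 1, 0], by decide, by decide⟩ : Equiv.Perm (Fin 5))} : Finset (Equiv.Perm (Fin 5))), v ∈ (univ.filter fun σ : Equiv.Perm (Fin 5) => ∀ σ' : Equiv.Perm (Fin 5),
      (univ.val.map fun b : Fin 5 => (σ' b : ℤ) - b) = (univ.val.map fun b : Fin 5 => (σ b : ℤ) - b) → σ' = σ) := by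
  decide +kernel

/-- bookkeeping for the hub split (membership / disjointness of explicit permutation sets; `decide +kernel`). -/
theorem five_hub_factA1 :
    ∀ v ∈ ({(⟨![1, 3, 0, 4, 2], ![2, 0, 4, 1, 3], by decide, by decide⟩ : Equiv.Perm (Fin 5)),
        (⟨![4, 3, 1, 2, 0], ![4, 2, 3, 1, 0], by decide, by decide⟩ : Equiv.Perm (Fin 5)),
        (⟨![2, 0, 4, 1, 3], ![1, 3, 0, 4, 2], by decide, by decide⟩ : Equiv.Perm (Fin 5)),
        (⟨![4, 2, 3, 1, 0], ![4, 3, 1, 2, 0], by decide, by decide⟩ : Equiv.Perm (Fin 5))} : Finset (Equiv.Perm (Fin 5))),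
      v ∈ (univ.filter fun σ : Equiv.Perm (Fin 5) => ∀ σ' : Equiv.Perm (Fin 5),
      (univ.val.map fun b : Fin 5 => (σ' b : ℤ) - b) = (univ.val.map fun b : Fin 5 => (σ b : ℤ) - b) → σ' = σ) ∧ v ≠ (⟨![4, 3, 0, 1, 2], ![2, 3, 4, 1, 0], by decide, by decide⟩ : Equiv.Perm (Fin 5)) ∧
      v ∉ ({(⟨![2, 3, 4, 0, 1], ![3, 4, 0, 1, 2], by decide, by decide⟩ : Equiv.Perm (Fin 5)),
        (⟨![4, 3, 2, 1, 0], ![4, 3, 2, 1, 0], by decide, by decide⟩ : Equiv.Perm (Fin 5)),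
        (⟨![2, 3, 4, 1, 0], ![4, 3, 0, 1, 2], by decide, by decide⟩ : Equiv.Perm (Fin 5)),
        (⟨![4, 3, 2, 0, 1], ![3, 4, 2, 1, 0], by decide, by decide⟩ : Equiv.Perm (Fin 5))} : Finset (Equiv.Perm (Fin 5))) ∧
      v ∉ ({(⟨![3, 4, 0, 1, 2], ![2, 3, 4, 0, 1], by decide, by decide⟩ : Equiv.Perm (Fin 5)),
        (⟨![4, 1, 2, 3, 0], ![4, 1, 2, 3, 0], by decide, by decide⟩ : Equiv.Perm (Fin 5)),
        (⟨![3, 4, 2, 1, 0], ![4, 3, 2, 0, 1], by decide, by decide⟩ : Equiv.Perm (Fin 5)),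
        (⟨![4, 1, 0, 3, 2], ![2, 1, 4, 3, 0], by decide, by decide⟩ : Equiv.Perm (Fin 5))} : Finset (Equiv.Perm (Fin 5))) := by
  decide +kernel

/-- bookkeeping for the hub split (membership / disjointness of explicit permutation sets; `decide +kernel`). -/
theorem five_hub_factA2 :
    ∀ v ∈ ({(⟨![2, 3, 4, 0, 1], ![3, 4, 0, 1, 2], by decide, by decide⟩ : Equiv.Perm (Fin 5)),
        (⟨![4, 3, 2, 1, 0], ![4, 3, 2, 1, 0], by decide, by decide⟩ : Equiv.Perm (Fin 5)),
        (⟨![2, 3, 4, 1, 0], ![4, 3, 0, 1, 2], by decide, by decide⟩ : Equiv.Perm (Fin 5)),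
        (⟨![4, 3, 2, 0, 1], ![3, 4, 2, 1, 0], by decide, by decide⟩ : Equiv.Perm (Fin 5))} : Finset (Equiv.Perm (Fin 5))),
      v ∈ (univ.filter fun σ : Equiv.Perm (Fin 5) => ∀ σ' : Equiv.Perm (Fin 5),
      (univ.val.map fun b : Fin 5 => (σ' b : ℤ) - b) = (univ.val.map fun b : Fin 5 => (σ b : ℤ) - b) → σ' = σ) ∧ v ≠ (⟨![4, 3, 0, 1, 2], ![2, 3, 4, 1, 0], by decide, by decide⟩ : Equiv.Perm (Fin 5)) ∧
      v ∉ ({(⟨![3, 4, 0, 1, 2], ![2, 3, 4, 0, 1], by decide, by decide⟩ : Equiv.Perm (Fin 5)),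
        (⟨![4, 1, 2, 3, 0], ![4, 1, 2, 3, 0], by decide, by decide⟩ : Equiv.Perm (Fin 5)),
        (⟨![3, 4, 2, 1, 0], ![4, 3, 2, 0, 1], by decide, by decide⟩ : Equiv.Perm (Fin 5)),
        (⟨![4, 1, 0, 3, 2], ![2, 1, 4, 3, 0], by decide, by decide⟩ : Equiv.Perm (Fin 5))} : Finset (Equiv.Perm (Fin 5))) := by
  decide +kernel

/-- bookkeeping for the hub split (membership / disjointness of explicit permutation sets; `decide +kernel`). -/
theorem five_hub_factA3 :
    ∀ v ∈ ({(⟨![3, 4, 0, 1, 2], ![2, 3, 4, 0, 1], by decide, by decide⟩ : Equiv.Perm (Fin 5)),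
        (⟨![4, 1, 2, 3, 0], ![4, 1, 2, 3, 0], by decide, by decide⟩ : Equiv.Perm (Fin 5)),
        (⟨![3, 4, 2, 1, 0], ![4, 3, 2, 0, 1], by decide, by decide⟩ : Equiv.Perm (Fin 5)),
        (⟨![4, 1, 0, 3, 2], ![2, 1, 4, 3, 0], by decide, by decide⟩ : Equiv.Perm (Fin 5))} : Finset (Equiv.Perm (Fin 5))),
      v ∈ (univ.filter fun σ : Equiv.Perm (Fin 5) => ∀ σ' : Equiv.Perm (Fin 5),
      (univ.val.map fun b : Fin 5 => (σ' b : ℤ) - b) = (univ.val.map fun b : Fin 5 => (σ b : ℤ) - b) → σ' = σ) ∧ v ≠ (⟨![4, 3, 0, 1, 2], ![2, 3, 4, 1, 0], by decide, by decide⟩ : Equiv.Perm (Fin 5)) := by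
  decide +kernel

/-- bookkeeping for the hub split (membership / disjointness of explicit permutation sets; `decide +kernel`). -/
theorem five_hub_factA0 :
    (⟨![4, 3, 0, 1, 2], ![2, 3, 4, 1, 0], by decide, by decide⟩ : Equiv.Perm (Fin 5)) ∈
      (univ.filter fun σ : Equiv.Perm (Fin 5) => ∀ σ' : Equiv.Perm (Fin 5),
      (univ.val.map fun b : Fin 5 => (σ' b : ℤ) - b) = (univ.val.map fun b : Fin 5 => (σ b : ℤ) - b) → σ' = σ) := by
  decide +kernel

/-- case B of the hub split: the hub `43012` IS a member ⇒ `N + 1 ≤ 16`. [folklore] -/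
theorem five_hub_member_le (ψ α : ℤ → ℤ) (P : ℤ → Prop) {N : ℕ} (θ' : Fin (N + 1) → ℤ)
    (τ : Fin (N + 1) → Equiv.Perm (Fin 5)) (hθ : StrictMono θ') (hinj : Function.Injective τ)
    (hτP : ∀ k b, P ((τ k b : ℤ) - b))
    (huniq : ∀ k (σ : Equiv.Perm (Fin 5)), σ ≠ τ k → (∀ b, P ((σ b : ℤ) - b)) →
      ∑ b, (θ' k * ψ ((σ b : ℤ) - b) + α ((σ b : ℤ) - b)) <
        ∑ b, (θ' k * ψ ((τ k b : ℤ) - b) + α ((τ k b : ℤ) - b)))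
    (hhub : (⟨![4, 3, 0, 1, 2], ![2, 3, 4, 1, 0], by decide, by decide⟩ : Equiv.Perm (Fin 5)) ∈ univ.image τ) :
    N + 1 ≤ 16 := by
  have hsub := image_subset_unshared ψ α P θ' τ hτP huniq
  have hcard : (univ.image τ).card = N + 1 := by
    rw [card_image_of_injective _ hinj, card_univ, Fintype.card_fin]
  set U := univ.filter fun σ : Equiv.Perm (Fin 5) => ∀ σ' : Equiv.Perm (Fin 5),
      (univ.val.map fun b : Fin 5 => (σ' b : ℤ) - b) = (univ.val.map fun b : Fin 5 => (σ b : ℤ) - b) → σ' = σ with hU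
  have hUcard : U.card = 20 := by rw [hU]; exact card_unshared_five
  let h0 : Equiv.Perm (Fin 5) := ⟨![4, 3, 0, 1, 2], ![2, 3, 4, 1, 0], by decide, by decide⟩   -- 43012 (hub)
  let a1 : Equiv.Perm (Fin 5) := ⟨![1, 3, 0, 4, 2], ![2, 0, 4, 1, 3], by decide, by decide⟩   -- 13042
  let a2 : Equiv.Perm (Fin 5) := ⟨![4, 3, 1, 2, 0], ![4, 2, 3, 1, 0], by decide, by decide⟩   -- 43120
  let a3 : Equiv.Perm (Fin 5) := ⟨![2, 0, 4, 1, 3], ![1, 3, 0, 4, 2], by decide, by decide⟩   -- 20413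
  let a4 : Equiv.Perm (Fin 5) := ⟨![4, 2, 3, 1, 0], ![4, 3, 1, 2, 0], by decide, by decide⟩   -- 42310
  let b1 : Equiv.Perm (Fin 5) := ⟨![2, 3, 4, 0, 1], ![3, 4, 0, 1, 2], by decide, by decide⟩   -- 23401
  let b2 : Equiv.Perm (Fin 5) := ⟨![4, 3, 2, 1, 0], ![4, 3, 2, 1, 0], by decide, by decide⟩   -- 43210
  let b3 : Equiv.Perm (Fin 5) := ⟨![2, 3, 4, 1, 0], ![4, 3, 0, 1, 2], by decide, by decide⟩   -- 23410
  let b4 : Equiv.Perm (Fin 5) := ⟨![4, 3, 2, 0, 1], ![3, 4, 2, 1, 0], by decide, by decide⟩   -- 43201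
  let c1 : Equiv.Perm (Fin 5) := ⟨![3, 4, 0, 1, 2], ![2, 3, 4, 0, 1], by decide, by decide⟩   -- 34012
  let c2 : Equiv.Perm (Fin 5) := ⟨![4, 1, 2, 3, 0], ![4, 1, 2, 3, 0], by decide, by decide⟩   -- 41230
  let c3 : Equiv.Perm (Fin 5) := ⟨![3, 4, 2, 1, 0], ![4, 3, 2, 0, 1], by decide, by decide⟩   -- 34210
  let c4 : Equiv.Perm (Fin 5) := ⟨![4, 1, 0, 3, 2], ![2, 1, 4, 3, 0], by decide, by decide⟩   -- 41032
  let d1 : Equiv.Perm (Fin 5) := ⟨![1, 2, 3, 4, 0], ![4, 0, 1, 2, 3], by decide, by decide⟩   -- 12340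
  let e1 : Equiv.Perm (Fin 5) := ⟨![2, 1, 4, 3, 0], ![4, 1, 0, 3, 2], by decide, by decide⟩   -- 21430
  let f2 : Equiv.Perm (Fin 5) := ⟨![3, 4, 1, 2, 0], ![4, 2, 3, 0, 1], by decide, by decide⟩   -- 34120
  let g1 : Equiv.Perm (Fin 5) := ⟨![3, 4, 2, 0, 1], ![3, 4, 2, 0, 1], by decide, by decide⟩   -- 34201
  -- CASE B: the hub is a member; its three link triples and one disjoint quadruple each lose a member
  have hhub' : h0 ∈ univ.image τ := hhub
  have mB1 := exists_not_mem_image_of_additive ψ α P θ' τ hθ hinj hτP huniq d1 h0 a1 a4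
    (by decide) (by decide) (by decide) (by decide) (by decide)
  have mB2 := exists_not_mem_image_of_additive ψ α P θ' τ hθ hinj hτP huniq e1 h0 b3 c4
    (by decide) (by decide) (by decide) (by decide) (by decide)
  have mB3 := exists_not_mem_image_of_additive ψ α P θ' τ hθ hinj hτP huniq c1 a2 f2 h0
    (by decide) (by decide) (by decide) (by decide) (by decide)
  have mB4 := exists_not_mem_image_of_additive ψ α P θ' τ hθ hinj hτP huniq g1 b2 c3 b4
    (by decide) (by decide) (by decide) (by decide) (by decide)
  obtain ⟨x, hx, hxτ⟩ := mB1
  obtain ⟨y, hy, hyτ⟩ := mB2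
  obtain ⟨z, hz, hzτ⟩ := mB3
  obtain ⟨w, hw, hwτ⟩ := mB4
  -- the missing elements are not the hub, hence lie in the link triples / the quadruple, pairwise disjoint subsets of `U`
  have hx0 : x ≠ h0 := fun e => hxτ (e ▸ hhub')
  have hy0 : y ≠ h0 := fun e => hyτ (e ▸ hhub')
  have hz0 : z ≠ h0 := fun e => hzτ (e ▸ hhub')
  have hxU := five_hub_factB1 x hx hx0
  have hyU := five_hub_factB2 y hy hy0
  have hzU := five_hub_factB3 z hz hz0
  have hwU := five_hub_factB4 w hw
  rw [← hU] at hxU hyU hzU hwU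
  have hxy : x ≠ y := fun e => hxU.2.1 (e ▸ hy)
  have hxz : x ≠ z := fun e => hxU.2.2.1 (e ▸ hz)
  have hxw : x ≠ w := fun e => hxU.2.2.2 (e ▸ hw)
  have hyz : y ≠ z := fun e => hyU.2.1 (e ▸ hz)
  have hyw : y ≠ w := fun e => hyU.2.2 (e ▸ hw)
  have hzw : z ≠ w := fun e => hzU.2 (e ▸ hw)
  have hsub' : univ.image τ ⊆ (((U.erase x).erase y).erase z).erase w := by
    intro v hv
    simp only [mem_erase]
    exact ⟨fun e => hwτ (e ▸ hv), fun e => hzτ (e ▸ hv), fun e => hyτ (e ▸ hv), fun e => hxτ (e ▸ hv), hsub hv⟩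
  have hc := card_le_card hsub'
  rw [card_erase_of_mem (by simp only [mem_erase]; exact ⟨hzw.symm, hyw.symm, hxw.symm, hwU⟩),
    card_erase_of_mem (by simp only [mem_erase]; exact ⟨hyz.symm, hxz.symm, hzU.1⟩),
    card_erase_of_mem (by simp only [mem_erase]; exact ⟨hxy.symm, hyU.1⟩), card_erase_of_mem hxU.1, hUcard, hcard] at hc
  omega

/-- case A of the hub split: the hub `43012` is NOT a member ⇒ `N + 1 ≤ 16`. [folklore] -/
theorem five_hub_nonmember_le (ψ α : ℤ → ℤ) (P : ℤ → Prop) {N : ℕ} (θ' : Fin (N + 1) → ℤ)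
    (τ : Fin (N + 1) → Equiv.Perm (Fin 5)) (hθ : StrictMono θ') (hinj : Function.Injective τ)
    (hτP : ∀ k b, P ((τ k b : ℤ) - b))
    (huniq : ∀ k (σ : Equiv.Perm (Fin 5)), σ ≠ τ k → (∀ b, P ((σ b : ℤ) - b)) →
      ∑ b, (θ' k * ψ ((σ b : ℤ) - b) + α ((σ b : ℤ) - b)) <
        ∑ b, (θ' k * ψ ((τ k b : ℤ) - b) + α ((τ k b : ℤ) - b)))
    (hhub : (⟨![4, 3, 0, 1, 2], ![2, 3, 4, 1, 0], by decide, by decide⟩ : Equiv.Perm (Fin 5)) ∉ univ.image τ) :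
    N + 1 ≤ 16 := by
  have hsub := image_subset_unshared ψ α P θ' τ hτP huniq
  have hcard : (univ.image τ).card = N + 1 := by
    rw [card_image_of_injective _ hinj, card_univ, Fintype.card_fin]
  set U := univ.filter fun σ : Equiv.Perm (Fin 5) => ∀ σ' : Equiv.Perm (Fin 5),
      (univ.val.map fun b : Fin 5 => (σ' b : ℤ) - b) = (univ.val.map fun b : Fin 5 => (σ b : ℤ) - b) → σ' = σ with hU
  have hUcard : U.card = 20 := by rw [hU]; exact card_unshared_five
  let h0 : Equiv.Perm (Fin 5) := ⟨![4, 3, 0, 1, 2], ![2, 3, 4, 1, 0], by decide, by decide⟩   -- 43012 (hub)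
  let a1 : Equiv.Perm (Fin 5) := ⟨![1, 3, 0, 4, 2], ![2, 0, 4, 1, 3], by decide, by decide⟩   -- 13042
  let a2 : Equiv.Perm (Fin 5) := ⟨![4, 3, 1, 2, 0], ![4, 2, 3, 1, 0], by decide, by decide⟩   -- 43120
  let a3 : Equiv.Perm (Fin 5) := ⟨![2, 0, 4, 1, 3], ![1, 3, 0, 4, 2], by decide, by decide⟩   -- 20413
  let a4 : Equiv.Perm (Fin 5) := ⟨![4, 2, 3, 1, 0], ![4, 3, 1, 2, 0], by decide, by decide⟩   -- 42310
  let b1 : Equiv.Perm (Fin 5) := ⟨![2, 3, 4, 0, 1], ![3, 4, 0, 1, 2], by decide, by decide⟩   -- 23401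
  let b2 : Equiv.Perm (Fin 5) := ⟨![4, 3, 2, 1, 0], ![4, 3, 2, 1, 0], by decide, by decide⟩   -- 43210
  let b3 : Equiv.Perm (Fin 5) := ⟨![2, 3, 4, 1, 0], ![4, 3, 0, 1, 2], by decide, by decide⟩   -- 23410
  let b4 : Equiv.Perm (Fin 5) := ⟨![4, 3, 2, 0, 1], ![3, 4, 2, 1, 0], by decide, by decide⟩   -- 43201
  let c1 : Equiv.Perm (Fin 5) := ⟨![3, 4, 0, 1, 2], ![2, 3, 4, 0, 1], by decide, by decide⟩   -- 34012
  let c2 : Equiv.Perm (Fin 5) := ⟨![4, 1, 2, 3, 0], ![4, 1, 2, 3, 0], by decide, by decide⟩   -- 41230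
  let c3 : Equiv.Perm (Fin 5) := ⟨![3, 4, 2, 1, 0], ![4, 3, 2, 0, 1], by decide, by decide⟩   -- 34210
  let c4 : Equiv.Perm (Fin 5) := ⟨![4, 1, 0, 3, 2], ![2, 1, 4, 3, 0], by decide, by decide⟩   -- 41032
  let d1 : Equiv.Perm (Fin 5) := ⟨![1, 2, 3, 4, 0], ![4, 0, 1, 2, 3], by decide, by decide⟩   -- 12340
  let e1 : Equiv.Perm (Fin 5) := ⟨![2, 1, 4, 3, 0], ![4, 1, 0, 3, 2], by decide, by decide⟩   -- 21430
  let f2 : Equiv.Perm (Fin 5) := ⟨![3, 4, 1, 2, 0], ![4, 2, 3, 0, 1], by decide, by decide⟩   -- 34120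
  let g1 : Equiv.Perm (Fin 5) := ⟨![3, 4, 2, 0, 1], ![3, 4, 2, 0, 1], by decide, by decide⟩   -- 34201
  -- CASE A: the hub is not a member; three disjoint quadruples avoiding it each lose a member
  have hhub' : h0 ∉ univ.image τ := hhub
  have mA1 := exists_not_mem_image_of_additive ψ α P θ' τ hθ hinj hτP huniq a1 a2 a3 a4
    (by decide) (by decide) (by decide) (by decide) (by decide)
  have mA2 := exists_not_mem_image_of_additive ψ α P θ' τ hθ hinj hτP huniq b1 b2 b3 b4
    (by decide) (by decide) (by decide) (by decide) (by decide)
  have mA3 := exists_not_mem_image_of_additive ψ α P θ' τ hθ hinj hτP huniq c1 c2 c3 c4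
    (by decide) (by decide) (by decide) (by decide) (by decide)
  obtain ⟨x, hx, hxτ⟩ := mA1
  obtain ⟨y, hy, hyτ⟩ := mA2
  obtain ⟨z, hz, hzτ⟩ := mA3
  have hh0U : h0 ∈ U := by rw [hU]; exact five_hub_factA0
  have hxU := five_hub_factA1 x hx
  have hyU := five_hub_factA2 y hy
  have hzU := five_hub_factA3 z hz
  rw [← hU] at hxU hyU hzU
  have hxy : x ≠ y := fun e => hxU.2.2.1 (e ▸ hy)
  have hxz : x ≠ z := fun e => hxU.2.2.2 (e ▸ hz)
  have hyz : y ≠ z := fun e => hyU.2.2 (e ▸ hz)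
  have hsub' : univ.image τ ⊆ (((U.erase h0).erase x).erase y).erase z := by
    intro v hv
    simp only [mem_erase]
    exact ⟨fun e => hzτ (e ▸ hv), fun e => hyτ (e ▸ hv), fun e => hxτ (e ▸ hv), fun e => hhub' (e ▸ hv), hsub hv⟩
  have hc := card_le_card hsub'
  rw [card_erase_of_mem (by simp only [mem_erase]; exact ⟨hyz.symm, hxz.symm, hzU.2, hzU.1⟩),
    card_erase_of_mem (by simp only [mem_erase]; exact ⟨hxy.symm, hyU.2.1, hyU.1⟩),
    card_erase_of_mem (by simp only [mem_erase]; exact ⟨hxU.2.1, hxU.1⟩), card_erase_of_mem hh0U, hUcard, hcard] at hc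
  omega


/-- **`Φ_Toep(5) ≤ 16`** (one-hub split at `43012`, see the module docstring). [folklore] -/
theorem linearInstanceBound_five_sixteen : LinearInstanceBound 5 16 := by
  intro ψ α P N θ' τ hθ hinj hτP huniq
  by_cases hhub : (⟨![4, 3, 0, 1, 2], ![2, 3, 4, 1, 0], by decide, by decide⟩ : Equiv.Perm (Fin 5)) ∈ univ.image τ
  · exact five_hub_member_le ψ α P θ' τ hθ hinj hτP huniq hhub
  · exact five_hub_nonmember_le ψ α P θ' τ hθ hinj hτP huniq hhub

/-- **THE `m = 5` ROW after this file: `13 ≤ Φ_Toep(5) ≤ 16`.** -/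
theorem linearInstanceBound_five_of_sixteen_le (Φ : ℕ) (hΦ : 16 ≤ Φ) : LinearInstanceBound 5 Φ :=
  linearInstanceBound_five_sixteen.mono hΦ

end FiveHub

end Summit.ValiantsHypothesis.ValiantsHypothesis.Theorems.KPlusLogSqLaw.Toeplitz
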